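import Summits.QuantumFields.BalabanUV.T4Continuum.Support.ShellMeasurePinnedDressOneTuple
import Summits.QuantumFields.BalabanUV.T4Continuum.Support.ShellMeasureRayTermsPinnedLower

/-!
# `T4Continuum.ShellMeasureRayTermsPinnedLandauW` — ROW S113 «THE 𝓔-LEG READS THE w-TUPLE's PINNED DRESS», file 2: S71 f2's
# non-Wilson supplier `hE_landau_chartRay_pinned` (and S108 f3a's lower bound `hElb_landau_chartRay_pinned`) FIRED at the (T2)
# tuple read in S69's pinned spaces — the e-leg's four linear letters := `kerOpPin` of the DISPLAYED kernels `k𝒢 kH₁ kH kι` at pin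
# rate `δw`, its (P4) letter := `W𝒱w` through the pins, its coarse datum := `Φw` through the pin; their rows DISCHARGED from the
# decay rows + reduced-rate sums + three Schur numbers (S69 (A), file 1); the 𝓔-TERM rows STAY
(cell `pub-balaban`, sub-cell `t4`, spine estimate NE7c (node U5b); NE7c ROUND-2 crew `t4-ne7c-formalise-*`, unit
`b2b-balaban-t4-ne7c-formalise-leaf-01` gen 11; owner table `t4/b2b-balaban-t4-ne7c-p1/LEAVES-NE7c-P1.md` **ROW S113** (owner ruling
R-ne7cp1-g37-1 (c1), journal l.22905: O-ne7cleaf01g11-1 ACCEPTED as the designed reading — «ONE term of (2.18) has ONE exponent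
field»; GO NOW as a LEMMA file consumed by the v6 ROOT S112 f3 = S80 f3′); ADDITIVE — imports file 1 `ShellMeasurePinnedDressOneTuple`
(this row) and S108 f3a `ShellMeasureRayTermsPinnedLower` (leaf-07-g10, p238754; hence S71 f2 `ShellMeasureRayTermsPinnedLandau`)
ONLY; [folklore]; 0 `def`, 0 `def … : Prop`, 0 sorry, 0 citation)

HONEST FRAMING.  Finite four-torus programme, rung (B)+1 only — NOT infinite volume, NOT a mass gap, NOT the Clay problem, NOT
summit progress; (B), `BetaPertHyp`, (B^μ) not consumed.  NE7c (`T4IndicatorShell.ShellWeightBound`) is NOT PRINTED in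
[Balaban 1983–89] and NOT PROVED; «NE7c ⇐ the named binders» (trigger c3).  A JUNCTION ON OUR TYPING: the hosts of record display
the k-th scheme step TWICE — (T2) as kernels on flat pi-types for the Wilson leg, (T3) as abstract continuous linear maps between
pinned spaces for the non-Wilson leg; by [Balaban1988Convergent] (2.18)∕(2.23) ONE term has ONE exponent field (WALL R19 `hRdict`
«of ONE exponent field»), and S69's `kerOpPin k δ′ (ϖ∘posIn) (ϖ∘posOut)` IS a map between exactly (T3)'s spaces.  Nothing of
[Balaban1985BackgroundPropagators] (3.133)∕Thm 3.3, [Balaban1985Variational] (46)∕(73)∕(103)∕Prop. 4, [Balaban1987RG1] Thm 1 is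
asserted, cited or discharged; the decay rows, the flat (P4) pair, the term pairs STAY displayed in the consumer.  HONEST DEPENDENCY
(cell): continuum YM on T⁴ ⇐ BetaPertH ∧ nine spine estimates (0/9 proved); BetaPertH ⇐ (D1) ∧ (D4) ∧ CAP+tail; G-an2-4 gates asym,
D1 and NE2/3/4.

WHAT IS PROVED ([folklore]; one exterior section at a time — the ROOT calls it per `V` exactly as S80 f3 calls S71 f2).
* **`hE_landau_chartRay_pinned_w`** — S71 f2 `hE_landau_chartRay_pinned` with `𝒴 := WSup (pinW δw (ϖw ∘ pos)) 1 𝔄w` (`Λ := Λw`),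
  `𝒢 := kerOpPin k𝒢 δw (ϖw∘posz) (ϖw∘pos)`, `W𝒱 := toPiLz.symm ∘ W𝒱w ∘ toPiL`, `H₁ := kerOpPin kH₁ δw (ϖw∘posb) (ϖw∘pos)`,
  `Φ := toPiLb.symm ∘ Φw`, `ι := kerOpPin kι δw (ϖw∘pos) (ϖw∘pos′)`, `H := kerOpPin kH δw (ϖw∘posx) (ϖw∘pos)`, letters
  `B₀ := B₀w`, `C₄ := C₄w·e^{δw·rW}`, `a₃ := a₃w`, `b := bw`, `rΦ := rΦw`, `δ′ := δw`, `ϖ := ϖw ∘ pos`.  INPUTS: S80 f3's (T2) rows for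
  `k𝒢 kH₁ kH` (decay at rate `δ·`, reduced-rate sums `Σ e^{−(δ·−δw)·dis} ≤ M·`, signs), the one-sided-Lipschitz pin `hϖw` and ITS SIGN
  `hϖ0 : 0 ≤ ϖw` (ENTERING — a distance to the block; `pinDist_nonneg` once S110 reads it on the torus), the three Schur numbers
  `hB𝒢w hBH₁w hBHw : c·M· ≤ B₀w` (ENTERING at the root; = S108 f2's rows higher up the chain, shared), `hB₀w`, the flat (P4) pair
  `hWw` with locality `hlocW` and reach `hreachW`, the analytic datum `hΦdw hΦ0w hΦbw` with its block support `hsupp` and `S < rΦw`, the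
  e-leg's OWN numbers `hε₄e hdome hselfe hcontre hq hRC` IN THE w-LETTERS, its pinned restriction row `hιew` (kept 1:1 — `cι·Mι ≤ 1`
  is no faithful stand-in), its Landau-correction pair `hC₂ hCq hCd` between the pinned spaces `WSup (pinW δw (ϖw∘pos′)) 1 𝔄′ →
  WSup (pinW δw (ϖw∘posx)) 1 𝔅` (abstract here; CfP's conjugate higher up), the located term data `I hrE hEd hEb he0 supp hblind ϖP
  hdepth hK hcoupE` (depth against `ϖw ∘ pos`, rate `δw`).  CONCLUSION = S71 f2's `hE` shape BY NAME with those instances: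
  `𝓔(c′•x) ≤ 𝓔 x + (1 − c′)·(3·(LK·(2z̄))∕(rΦw∕S − 1))`, `z̄ = (ε₄e + B₀w·bw) + B₀w·(4C₂(ε₄e + B₀w·bw)²)`.
* **`hElb_landau_chartRay_pinned_w`** — S108 f3a `hElb_landau_chartRay_pinned` at the same instances: the consumer's `hElb₁` body at
  `BE₁ := Σ_{i∈I} e i` (for the middle link S108 f3′ of the v6 chain, R-ne7cp1-g37-1 (c3)).
LEAVING IN THE CONSUMER (vs S71 f2's ∕ S80 f3's (T3) block): the data `𝒢e W𝒱e H₁e Φe ιe He`, the letters `B₀e C₄e a₃e be rΦe δ′ ϖ`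
and carriers `Λe 𝔄 𝒵e ℬe` (`𝒴e′ 𝒳e` become the pinned spaces on `Λw′`, `Λx`), the rows `h𝒢e hWe hB₀e hC₄e hbe hH₁e hΦde hΦ0e hΦbe
hSre hHe hδ′ hϖ`; `hιe` is RE-TYPED 1:1 as `hιew`; ENTERING `hϖ0` + `hB𝒢w hBH₁w hBHw`.  DISPLAYED, NOT DISCHARGED (c2): everything of
Bałaban's TYPE; NOTHING in the countdown moves; NE7c NOT PROVED; spine PROVED 0∕9.
-/

noncomputable section

open Set Metric Function

namespace Summit.QuantumFields.BalabanUV.T4Continuum.ShellMeasureRayTermsPinnedLandauW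

open Literature.MathematicalPhysics.QuantumFieldTheory.Balaban1983to89
open B11Prop6Scheme (Prop4Hyp)
open Summit.QuantumFields.BalabanUV.T4Continuum.ShellMeasureMultiGridNorms (WSup)
open Summit.QuantumFields.BalabanUV.T4Continuum.ShellMeasureMultiGridNorms.WSup (toPiL)
open Summit.QuantumFields.BalabanUV.T4Continuum.ShellMeasureDecayKernelSums (kerOp)
open Summit.QuantumFields.BalabanUV.T4Continuum.ShellMeasurePinnedNorm (pinW kerOpPin)
open Summit.QuantumFields.BalabanUV.T4Continuum.ShellMeasurePinnedProp4 (norm_ofPin_le_of_support)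
open Summit.QuantumFields.BalabanUV.T4Continuum.ShellMeasureLandauHolonomy (solAt landauExp)
open Summit.QuantumFields.BalabanUV.T4Continuum.ShellMeasureLandauHolonomyChart (cplx)
open Summit.QuantumFields.BalabanUV.T4Continuum.ShellMeasureRayTermsPinnedLandau (hE_landau_chartRay_pinned completeSpace_wsup)
open Summit.QuantumFields.BalabanUV.T4Continuum.ShellMeasureRayTermsPinnedLower (hElb_landau_chartRay_pinned)
open Summit.QuantumFields.BalabanUV.T4Continuum.ShellMeasurePinnedDressOneTuple (norm_kerOpPin_le_of_decay_junction
  prop4Hyp_pinned_of_local)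

variable {Λw Λz Λw' Λx Λb 𝔖 : Type*} [Fintype Λw] [Fintype Λz] [Fintype Λw'] [Fintype Λx] [Fintype Λb]
variable {𝔄w ℭ 𝔄' 𝔅 𝔇 : Type*} [NormedAddCommGroup 𝔄w] [NormedSpace ℂ 𝔄w] [CompleteSpace 𝔄w]
  [NormedAddCommGroup ℭ] [NormedSpace ℂ ℭ] [NormedAddCommGroup 𝔄'] [NormedSpace ℂ 𝔄']
  [NormedAddCommGroup 𝔅] [NormedSpace ℂ 𝔅] [CompleteSpace 𝔅] [NormedAddCommGroup 𝔇] [NormedSpace ℂ 𝔇]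

/-! ## §1 The coarse datum read through the pin: the three (75)-type binders transfer -/

section Datum

variable {m₀ : ℕ} {δw : ℝ}

omit [Fintype Λw] [Fintype Λz] [Fintype Λw'] [Fintype Λx] [NormedSpace ℂ 𝔄w] [CompleteSpace 𝔄w] [CompleteSpace 𝔅] in
/-- `Φ := toPiLb.symm ∘ Φw` is ℂ-differentiable where `Φw` is. [folklore] -/
theorem hΦd_pin (ϖb : Λb → ℝ) {Φw : (Fin m₀ → ℂ) → (Λb → 𝔇)} {rΦw : ℝ}
    (hΦdw : DifferentiableOn ℂ Φw (ball 0 rΦw)) :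
    DifferentiableOn ℂ (fun z => ((toPiL (pinW δw ϖb) 1).symm (Φw z) : WSup (pinW δw ϖb) 1 𝔇)) (ball 0 rΦw) :=
  (toPiL (𝔄 := 𝔇) (pinW δw ϖb) 1).symm.toContinuousLinearMap.differentiable.comp_differentiableOn hΦdw

omit [Fintype Λw] [Fintype Λz] [Fintype Λw'] [Fintype Λx] [NormedSpace ℂ 𝔄w] [CompleteSpace 𝔄w] [CompleteSpace 𝔅] in
/-- … vanishes at the centre where `Φw` does. [folklore] -/
theorem hΦ0_pin (ϖb : Λb → ℝ) {Φw : (Fin m₀ → ℂ) → (Λb → 𝔇)} (hΦ0w : Φw 0 = 0) :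
    ((toPiL (pinW δw ϖb) 1).symm (Φw 0) : WSup (pinW δw ϖb) 1 𝔇) = 0 := by
  rw [hΦ0w, map_zero]

omit [Fintype Λw] [Fintype Λz] [Fintype Λw'] [Fintype Λx] [NormedSpace ℂ 𝔄w] [CompleteSpace 𝔄w] [CompleteSpace 𝔅] in
/-- … and keeps the STRICT (75)-type bound when `Φw` is supported on the block `{ϖb ≤ 0}` (S75 §1: pinned size = flat size there).
[folklore] -/
theorem hΦb_pin (hδw : 0 ≤ δw) (ϖb : Λb → ℝ) {Φw : (Fin m₀ → ℂ) → (Λb → 𝔇)} {rΦw bw : ℝ}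
    (hΦbw : ∀ z ∈ ball (0 : Fin m₀ → ℂ) rΦw, ‖Φw z‖ < bw) (hsupp : ∀ z : Fin m₀ → ℂ, ∀ i, 0 < ϖb i → Φw z i = 0) :
    ∀ z ∈ ball (0 : Fin m₀ → ℂ) rΦw, ‖((toPiL (pinW δw ϖb) 1).symm (Φw z) : WSup (pinW δw ϖb) 1 𝔇)‖ < bw :=
  fun z hz => (norm_ofPin_le_of_support hδw ϖb (Φw z) (hsupp z)).trans_lt (hΦbw z hz)

end Datum

/-! ## §2 The non-Wilson supplier fired at the w-tuple's pinned dress -/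

section Supplier

variable {m₀ : ℕ} {δw : ℝ}

/-- **S71 f2's `hE` FOR THE LOCATED NON-WILSON TERMS, WITH THE 𝓔-LEG's SCHEME TUPLE READ OFF THE (T2) KERNELS IN THE PINNED
DRESS.**  See the module docstring for the instances and the binder list; the conclusion is LITERALLY S71 f2
`hE_landau_chartRay_pinned`'s at those instances (volume-free `B_𝓔 = 3·(LK·(2z̄))∕(rΦw∕S − 1)`,
`z̄ = (ε₄e + B₀w·bw) + B₀w·(4C₂(ε₄e + B₀w·bw)²)`).  Proof: file 1 §1 (three Schur numbers through S69 (A)), §2 (pinned (P4) by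
locality), this file's §1 (the datum through the pin), then ONE call of S71 f2 BY NAME.  Nothing of Bałaban's is asserted or
discharged. [folklore] -/
theorem hE_landau_chartRay_pinned_w (hδw : 0 ≤ δw) (ϖw : 𝔖 → ℝ) (hϖ0 : ∀ x, 0 ≤ ϖw x) (dis : 𝔖 → 𝔖 → ℝ)
    (hϖw : ∀ x y, ϖw x ≤ ϖw y + dis x y)
    (pos : Λw → 𝔖) (posz : Λz → 𝔖) (pos' : Λw' → 𝔖) (posx : Λx → 𝔖) (posb : Λb → 𝔖)
    {W : Set (Fin m₀ → ℝ)} {S : ℝ} (hS : 0 < S) (hWS : W ⊆ closedBall (0 : Fin m₀ → ℝ) S)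
    -- the three linear letters as DISPLAYED decay kernels with reduced-rate sums and the three Schur numbers
    (k𝒢 : Λw → Λz → (ℭ →L[ℂ] 𝔄w)) (kH₁ : Λw → Λb → (𝔇 →L[ℂ] 𝔄w)) (kH : Λw → Λx → (𝔅 →L[ℂ] 𝔄w))
    {c𝒢 δ𝒢 M𝒢 cH δH MH cH₁ δH₁ MH₁ B₀w : ℝ}
    (hc𝒢 : 0 ≤ c𝒢) (hM𝒢 : 0 ≤ M𝒢) (hk𝒢 : ∀ c b', ‖k𝒢 c b'‖ ≤ c𝒢 * Real.exp (-(δ𝒢 * dis (pos c) (posz b'))))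
    (hM𝒢' : ∀ x, ∑ b', Real.exp (-((δ𝒢 - δw) * dis x (posz b'))) ≤ M𝒢)
    (hcH : 0 ≤ cH) (hMH : 0 ≤ MH) (hkH : ∀ c b', ‖kH c b'‖ ≤ cH * Real.exp (-(δH * dis (pos c) (posx b'))))
    (hMH' : ∀ x, ∑ b', Real.exp (-((δH - δw) * dis x (posx b'))) ≤ MH)
    (hcH₁ : 0 ≤ cH₁) (hMH₁ : 0 ≤ MH₁) (hkH₁ : ∀ c b', ‖kH₁ c b'‖ ≤ cH₁ * Real.exp (-(δH₁ * dis (pos c) (posb b'))))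
    (hMH₁' : ∀ x, ∑ b', Real.exp (-((δH₁ - δw) * dis x (posb b'))) ≤ MH₁)
    (hB𝒢w : c𝒢 * M𝒢 ≤ B₀w) (hBH₁w : cH₁ * MH₁ ≤ B₀w) (hBHw : cH * MH ≤ B₀w) (hB₀w : 0 < B₀w)
    -- the flat (P4) letter with locality and reach
    (W𝒱w : (Λw → 𝔄w) → (Λz → ℭ)) {C₄w a₃w : ℝ} (hWw : Prop4Hyp W𝒱w C₄w a₃w) (hC₄w : 0 ≤ C₄w)
    (NW : Λz → Λw → Prop) (hlocW : ∀ A A' : Λw → 𝔄w, ∀ c', (∀ b', NW c' b' → A b' = A' b') → W𝒱w A c' = W𝒱w A' c')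
    {rW : ℝ} (hreachW : ∀ c' b', NW c' b' → ϖw (posz c') - rW ≤ ϖw (pos b'))
    -- the analytic coarse datum with its block support
    {Φw : (Fin m₀ → ℂ) → (Λb → 𝔇)} {rΦw bw : ℝ} (hΦdw : DifferentiableOn ℂ Φw (ball 0 rΦw)) (hΦ0w : Φw 0 = 0)
    (hΦbw : ∀ z ∈ ball (0 : Fin m₀ → ℂ) rΦw, ‖Φw z‖ < bw) (hSrw : S < rΦw)
    (hsupp : ∀ z : Fin m₀ → ℂ, ∀ i, 0 < ϖw (posb i) → Φw z i = 0)
    -- the e-leg's own numbers, in the w-letters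
    {ε₄e : ℝ} (hε₄e : 0 ≤ ε₄e) (hdome : 2 * (ε₄e + B₀w * bw) ≤ a₃w)
    (hselfe : B₀w * (C₄w * Real.exp (δw * rW)) * (ε₄e + B₀w * bw) ^ 2 ≤ ε₄e)
    (hcontre : 4 * B₀w * (C₄w * Real.exp (δw * rW)) * (ε₄e + B₀w * bw) < 1)
    -- the e-leg's Landau-correction pair between the pinned spaces, the pinned restriction row, the kernel `kι`
    {C : WSup (pinW δw (ϖw ∘ pos')) 1 𝔄' → WSup (pinW δw (ϖw ∘ posx)) 1 𝔅} {C₂ RC : ℝ} (hC₂ : 0 ≤ C₂)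
    (hCq : ∀ Z : WSup (pinW δw (ϖw ∘ pos')) 1 𝔄', ‖Z‖ < RC → ‖C Z‖ ≤ C₂ * ‖Z‖ ^ 2)
    (hCd : DifferentiableOn ℂ C (ball 0 RC))
    (kι : Λw' → Λw → (𝔄w →L[ℂ] 𝔄'))
    (hιew : ∀ Y : WSup (pinW δw (ϖw ∘ pos)) 1 𝔄w, ‖kerOpPin kι δw (ϖw ∘ pos) (ϖw ∘ pos') Y‖ ≤ ‖Y‖)
    (hq : 9 * C₂ * B₀w * (ε₄e + B₀w * bw) < 1) (hRC : 3 * (ε₄e + B₀w * bw) ≤ RC)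
    -- the LOCATED per-term functionals (depth against `ϖw ∘ pos`, rate `δw`) and the coupling
    {𝔱 : Type*} (I : Finset 𝔱) {Ef : 𝔱 → (Λw → 𝔄w) → ℂ} {rE : ℝ} {e : 𝔱 → ℝ} (hrE : 0 < rE)
    (hEd : ∀ i ∈ I, DifferentiableOn ℂ (Ef i) (ball 0 rE))
    (hEb : ∀ i ∈ I, ∀ Z ∈ ball (0 : Λw → 𝔄w) rE, ‖Ef i Z‖ ≤ e i) (he0 : ∀ i ∈ I, 0 ≤ e i)
    (supp : 𝔱 → Finset Λw) (hblind : ∀ i ∈ I, ∀ A A' : Λw → 𝔄w, (∀ b' ∈ supp i, A b' = A' b') → Ef i A = Ef i A')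
    (ϖP : 𝔱 → ℝ) (hdepth : ∀ i ∈ I, ∀ b' ∈ supp i, ϖP i ≤ ϖw (pos b'))
    {LK : ℝ} (hK : ∑ i ∈ I, 2 * e i / rE * Real.exp (-(δw * ϖP i)) ≤ LK)
    (hcoupE : (ε₄e + B₀w * bw) + B₀w * (4 * C₂ * (ε₄e + B₀w * bw) ^ 2) ≤ rE / 2) :
    ∀ x ∈ W, ∀ c' : ℝ, 1 / 2 ≤ c' → c' ≤ 1 →
      (fun y => (∑ i ∈ I, Ef i (WSup.toPiL (pinW δw (ϖw ∘ pos)) 1 (landauExp C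
        (kerOpPin kι δw (ϖw ∘ pos) (ϖw ∘ pos')) (kerOpPin kH δw (ϖw ∘ posx) (ϖw ∘ pos))
        (4 * C₂ * (ε₄e + B₀w * bw) ^ 2)
        (solAt (kerOpPin k𝒢 δw (ϖw ∘ posz) (ϖw ∘ pos)) 0
          (fun Y : WSup (pinW δw (ϖw ∘ pos)) 1 𝔄w =>
            ((toPiL (pinW δw (ϖw ∘ posz)) 1).symm (W𝒱w (toPiL (pinW δw (ϖw ∘ pos)) 1 Y)) : WSup (pinW δw (ϖw ∘ posz)) 1 ℭ))
          ε₄e (0 : WSup (pinW δw (ϖw ∘ posz)) 1 ℭ)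
          (kerOpPin kH₁ δw (ϖw ∘ posb) (ϖw ∘ pos) ((toPiL (pinW δw (ϖw ∘ posb)) 1).symm (Φw (cplx y)))) +
            kerOpPin kH₁ δw (ϖw ∘ posb) (ϖw ∘ pos) ((toPiL (pinW δw (ϖw ∘ posb)) 1).symm (Φw (cplx y))))))).re) (c' • x) ≤
      (fun y => (∑ i ∈ I, Ef i (WSup.toPiL (pinW δw (ϖw ∘ pos)) 1 (landauExp C
        (kerOpPin kι δw (ϖw ∘ pos) (ϖw ∘ pos')) (kerOpPin kH δw (ϖw ∘ posx) (ϖw ∘ pos))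
        (4 * C₂ * (ε₄e + B₀w * bw) ^ 2)
        (solAt (kerOpPin k𝒢 δw (ϖw ∘ posz) (ϖw ∘ pos)) 0
          (fun Y : WSup (pinW δw (ϖw ∘ pos)) 1 𝔄w =>
            ((toPiL (pinW δw (ϖw ∘ posz)) 1).symm (W𝒱w (toPiL (pinW δw (ϖw ∘ pos)) 1 Y)) : WSup (pinW δw (ϖw ∘ posz)) 1 ℭ))
          ε₄e (0 : WSup (pinW δw (ϖw ∘ posz)) 1 ℭ)
          (kerOpPin kH₁ δw (ϖw ∘ posb) (ϖw ∘ pos) ((toPiL (pinW δw (ϖw ∘ posb)) 1).symm (Φw (cplx y)))) +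
            kerOpPin kH₁ δw (ϖw ∘ posb) (ϖw ∘ pos) ((toPiL (pinW δw (ϖw ∘ posb)) 1).symm (Φw (cplx y))))))).re) x +
        (1 - c') * (3 * (LK * (2 * ((ε₄e + B₀w * bw) + B₀w * (4 * C₂ * (ε₄e + B₀w * bw) ^ 2)))) / (rΦw / S - 1)) := by
  haveI : CompleteSpace (WSup (pinW δw (ϖw ∘ posx)) 1 𝔅) := completeSpace_wsup _ 1
  -- positivity of the surviving letters
  have hbw : 0 < bw := by
    have h := hΦbw 0 (mem_ball_self (hS.trans hSrw)); rw [hΦ0w, norm_zero] at h; exact h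
  have ha₃w : 0 < a₃w := by
    have h0 : 0 < ε₄e + B₀w * bw := add_pos_of_nonneg_of_pos hε₄e (mul_pos hB₀w hbw)
    linarith
  have hC₄e : 0 ≤ C₄w * Real.exp (δw * rW) := by positivity
  -- the three linear letters (file 1 §1 over S69 (A)), the (P4) letter (file 1 §2), the datum (§1)
  have h𝒢e := norm_kerOpPin_le_of_decay_junction k𝒢 dis posz pos ϖw hc𝒢 hδw hM𝒢 hk𝒢 hϖw hM𝒢' hB𝒢w
  have hH₁e := norm_kerOpPin_le_of_decay_junction kH₁ dis posb pos ϖw hcH₁ hδw hMH₁ hkH₁ hϖw hMH₁' hBH₁w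
  have hHe := norm_kerOpPin_le_of_decay_junction kH dis posx pos ϖw hcH hδw hMH hkH hϖw hMH' hBHw
  have hWe := prop4Hyp_pinned_of_local hδw (ϖw ∘ pos) (fun b' => hϖ0 (pos b')) (ϖw ∘ posz) NW hlocW hreachW hC₄w
    ha₃w hWw
  exact hE_landau_chartRay_pinned hδw (fun b' => hϖ0 (pos b')) hS hWS h𝒢e hWe hB₀w hC₄e hε₄e hdome hselfe hcontre
    (kerOpPin kH₁ δw (ϖw ∘ posb) (ϖw ∘ pos)) hH₁e (hΦd_pin (ϖw ∘ posb) hΦdw) (hΦ0_pin (ϖw ∘ posb) hΦ0w)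
    (hΦb_pin hδw (ϖw ∘ posb) hΦbw hsupp) hSrw hC₂ hCq hCd (kerOpPin kι δw (ϖw ∘ pos) (ϖw ∘ pos')) hιew
    (kerOpPin kH δw (ϖw ∘ posx) (ϖw ∘ pos)) hHe hq hRC I hrE hEd hEb he0 supp hblind ϖP hdepth hK hcoupE

/-- **THE CONSUMER's LOWER-BOUND ROW `hElb₁` AT THE SAME INSTANCES** (S108 f3a `hElb_landau_chartRay_pinned` fired; `BE₁ := Σ_{i∈I} e i`)
— for the middle link S108 f3′ of the v6 chain (R-ne7cp1-g37-1 (c3)), on every real chart point `‖y‖ ≤ S`. [folklore] -/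
theorem hElb_landau_chartRay_pinned_w (hδw : 0 ≤ δw) (ϖw : 𝔖 → ℝ) (hϖ0 : ∀ x, 0 ≤ ϖw x) (dis : 𝔖 → 𝔖 → ℝ)
    (hϖw : ∀ x y, ϖw x ≤ ϖw y + dis x y)
    (pos : Λw → 𝔖) (posz : Λz → 𝔖) (pos' : Λw' → 𝔖) (posx : Λx → 𝔖) (posb : Λb → 𝔖) {S : ℝ} (hS : 0 < S)
    (k𝒢 : Λw → Λz → (ℭ →L[ℂ] 𝔄w)) (kH₁ : Λw → Λb → (𝔇 →L[ℂ] 𝔄w)) (kH : Λw → Λx → (𝔅 →L[ℂ] 𝔄w))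
    {c𝒢 δ𝒢 M𝒢 cH δH MH cH₁ δH₁ MH₁ B₀w : ℝ}
    (hc𝒢 : 0 ≤ c𝒢) (hM𝒢 : 0 ≤ M𝒢) (hk𝒢 : ∀ c b', ‖k𝒢 c b'‖ ≤ c𝒢 * Real.exp (-(δ𝒢 * dis (pos c) (posz b'))))
    (hM𝒢' : ∀ x, ∑ b', Real.exp (-((δ𝒢 - δw) * dis x (posz b'))) ≤ M𝒢)
    (hcH : 0 ≤ cH) (hMH : 0 ≤ MH) (hkH : ∀ c b', ‖kH c b'‖ ≤ cH * Real.exp (-(δH * dis (pos c) (posx b'))))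
    (hMH' : ∀ x, ∑ b', Real.exp (-((δH - δw) * dis x (posx b'))) ≤ MH)
    (hcH₁ : 0 ≤ cH₁) (hMH₁ : 0 ≤ MH₁) (hkH₁ : ∀ c b', ‖kH₁ c b'‖ ≤ cH₁ * Real.exp (-(δH₁ * dis (pos c) (posb b'))))
    (hMH₁' : ∀ x, ∑ b', Real.exp (-((δH₁ - δw) * dis x (posb b'))) ≤ MH₁)
    (hB𝒢w : c𝒢 * M𝒢 ≤ B₀w) (hBH₁w : cH₁ * MH₁ ≤ B₀w) (hBHw : cH * MH ≤ B₀w) (hB₀w : 0 < B₀w)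
    (W𝒱w : (Λw → 𝔄w) → (Λz → ℭ)) {C₄w a₃w : ℝ} (hWw : Prop4Hyp W𝒱w C₄w a₃w) (hC₄w : 0 ≤ C₄w)
    (NW : Λz → Λw → Prop) (hlocW : ∀ A A' : Λw → 𝔄w, ∀ c', (∀ b', NW c' b' → A b' = A' b') → W𝒱w A c' = W𝒱w A' c')
    {rW : ℝ} (hreachW : ∀ c' b', NW c' b' → ϖw (posz c') - rW ≤ ϖw (pos b'))
    {Φw : (Fin m₀ → ℂ) → (Λb → 𝔇)} {rΦw bw : ℝ} (hΦdw : DifferentiableOn ℂ Φw (ball 0 rΦw)) (hΦ0w : Φw 0 = 0)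
    (hΦbw : ∀ z ∈ ball (0 : Fin m₀ → ℂ) rΦw, ‖Φw z‖ < bw) (hSrw : S < rΦw)
    (hsupp : ∀ z : Fin m₀ → ℂ, ∀ i, 0 < ϖw (posb i) → Φw z i = 0)
    {ε₄e : ℝ} (hε₄e : 0 ≤ ε₄e) (hdome : 2 * (ε₄e + B₀w * bw) ≤ a₃w)
    (hselfe : B₀w * (C₄w * Real.exp (δw * rW)) * (ε₄e + B₀w * bw) ^ 2 ≤ ε₄e)
    (hcontre : 4 * B₀w * (C₄w * Real.exp (δw * rW)) * (ε₄e + B₀w * bw) < 1)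
    {C : WSup (pinW δw (ϖw ∘ pos')) 1 𝔄' → WSup (pinW δw (ϖw ∘ posx)) 1 𝔅} {C₂ RC : ℝ} (hC₂ : 0 ≤ C₂)
    (hCq : ∀ Z : WSup (pinW δw (ϖw ∘ pos')) 1 𝔄', ‖Z‖ < RC → ‖C Z‖ ≤ C₂ * ‖Z‖ ^ 2)
    (hCd : DifferentiableOn ℂ C (ball 0 RC))
    (kι : Λw' → Λw → (𝔄w →L[ℂ] 𝔄'))
    (hιew : ∀ Y : WSup (pinW δw (ϖw ∘ pos)) 1 𝔄w, ‖kerOpPin kι δw (ϖw ∘ pos) (ϖw ∘ pos') Y‖ ≤ ‖Y‖)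
    (hq : 9 * C₂ * B₀w * (ε₄e + B₀w * bw) < 1) (hRC : 3 * (ε₄e + B₀w * bw) ≤ RC)
    {𝔱 : Type*} (I : Finset 𝔱) {Ef : 𝔱 → (Λw → 𝔄w) → ℂ} {rE : ℝ} {e : 𝔱 → ℝ}
    (hEb : ∀ i ∈ I, ∀ Z ∈ ball (0 : Λw → 𝔄w) rE, ‖Ef i Z‖ ≤ e i)
    (hcoupE : (ε₄e + B₀w * bw) + B₀w * (4 * C₂ * (ε₄e + B₀w * bw) ^ 2) ≤ rE / 2) :
    ∀ y : Fin m₀ → ℝ, ‖y‖ ≤ S →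
      -(∑ i ∈ I, e i) ≤ (∑ i ∈ I, Ef i (WSup.toPiL (pinW δw (ϖw ∘ pos)) 1 (landauExp C
        (kerOpPin kι δw (ϖw ∘ pos) (ϖw ∘ pos')) (kerOpPin kH δw (ϖw ∘ posx) (ϖw ∘ pos))
        (4 * C₂ * (ε₄e + B₀w * bw) ^ 2)
        (solAt (kerOpPin k𝒢 δw (ϖw ∘ posz) (ϖw ∘ pos)) 0
          (fun Y : WSup (pinW δw (ϖw ∘ pos)) 1 𝔄w =>
            ((toPiL (pinW δw (ϖw ∘ posz)) 1).symm (W𝒱w (toPiL (pinW δw (ϖw ∘ pos)) 1 Y)) : WSup (pinW δw (ϖw ∘ posz)) 1 ℭ))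
          ε₄e (0 : WSup (pinW δw (ϖw ∘ posz)) 1 ℭ)
          (kerOpPin kH₁ δw (ϖw ∘ posb) (ϖw ∘ pos) ((toPiL (pinW δw (ϖw ∘ posb)) 1).symm (Φw (cplx y)))) +
            kerOpPin kH₁ δw (ϖw ∘ posb) (ϖw ∘ pos) ((toPiL (pinW δw (ϖw ∘ posb)) 1).symm (Φw (cplx y))))))).re := by
  haveI : CompleteSpace (WSup (pinW δw (ϖw ∘ posx)) 1 𝔅) := completeSpace_wsup _ 1
  have hbw : 0 < bw := by
    have h := hΦbw 0 (mem_ball_self (hS.trans hSrw)); rw [hΦ0w, norm_zero] at h; exact h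
  have ha₃w : 0 < a₃w := by
    have h0 : 0 < ε₄e + B₀w * bw := add_pos_of_nonneg_of_pos hε₄e (mul_pos hB₀w hbw)
    linarith
  have hC₄e : 0 ≤ C₄w * Real.exp (δw * rW) := by positivity
  have h𝒢e := norm_kerOpPin_le_of_decay_junction k𝒢 dis posz pos ϖw hc𝒢 hδw hM𝒢 hk𝒢 hϖw hM𝒢' hB𝒢w
  have hH₁e := norm_kerOpPin_le_of_decay_junction kH₁ dis posb pos ϖw hcH₁ hδw hMH₁ hkH₁ hϖw hMH₁' hBH₁w
  have hHe := norm_kerOpPin_le_of_decay_junction kH dis posx pos ϖw hcH hδw hMH hkH hϖw hMH' hBHw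
  have hWe := prop4Hyp_pinned_of_local hδw (ϖw ∘ pos) (fun b' => hϖ0 (pos b')) (ϖw ∘ posz) NW hlocW hreachW hC₄w
    ha₃w hWw
  exact hElb_landau_chartRay_pinned hδw (fun b' => hϖ0 (pos b')) hS h𝒢e hWe hB₀w hC₄e hε₄e hdome hselfe hcontre
    (kerOpPin kH₁ δw (ϖw ∘ posb) (ϖw ∘ pos)) hH₁e (hΦd_pin (ϖw ∘ posb) hΦdw) (hΦ0_pin (ϖw ∘ posb) hΦ0w)
    (hΦb_pin hδw (ϖw ∘ posb) hΦbw hsupp) hSrw hC₂ hCq hCd (kerOpPin kι δw (ϖw ∘ pos) (ϖw ∘ pos')) hιew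
    (kerOpPin kH δw (ϖw ∘ posx) (ϖw ∘ pos)) hHe hq hRC I hEb hcoupE

end Supplier

end Summit.QuantumFields.BalabanUV.T4Continuum.ShellMeasureRayTermsPinnedLandauW

end
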